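import Literature.MathematicalPhysics.QuantumFieldTheory.Balaban1983to89.B11Ineq190ActualDeriv
import Literature.MathematicalPhysics.QuantumFieldTheory.Balaban1983to89.B11Ineq73HasMajConcrete

/-!
# `Balaban1983to89.B11Ineq190DerivConcreteC` — T. Bałaban, *The variational problem and background fields in renormalization group method for
lattice gauge theories*, Commun. Math. Phys. **102** (1985) 277–309 [Balaban1985Variational], Prop. 9 / (190) p. 308 with Sect. C (44)/(47)/(72)/(73)
pp. 285–289: THE END-TO-END (190) CHAIN FOR THE FIRST-ORDER OUTPUT SIZES (`covDerivBlockSize`, `ofSeminorms … covDerivSize`) WITH THE SECT. C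
LETTERS FROM PROPOSITION 3, AT THE CONCRETE `C_j` OF [4], AND ON THE SINGLE-SCALE CUBE GEOMETRY WITH THE (73)-LETTER DISCHARGED — the
covariant-derivative twins of r08's `B11Ineq190FromProp3.ineq190_and_hmv_supSize_of_inputs` → `B11Ineq190ConcreteC.ineq190_and_hmv_supSize_concreteC`
→ `B11Ineq73HasMajConcrete.ineq190_and_hmv_supSize_concreteC_kernel`, for p29's `B11Ineq190ActualDeriv.ineq190_and_hmv_{covDerivBlockSize,ofSeminorms}_sectG`

statement-level skeleton of published theorems with citation tags; proofs where landed; nothing here is a claim about the Yang–Mills mass gap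

PDF held: `paper:balaban1985-cmp102-variational-background` (journal page = PDF page + 276); pp. 285–289 [PDF 9–13], 306–309 [PDF 30–33]; [4] =
[Balaban1985Averaging] `paper:balaban1985-cmp98-averaging` Props. 4–5 pp. 38–42; [3] = [Balaban1984PropagatorsII] Lemma 2.1 (2.61) p. 234, (2.54)
p. 233.

CITATION HEADER / WHAT IS REPRODUCED (lean-in-tree rule 2026-08-18).  Mega-formalization `lit-balaban`, HOME `run/shared/lean/pub/lit-balaban/`, seat
r12 gen 12 (unit `lit-balaban-r12`, B15 fold owner; free-target protocol G.5-34(d), lineage r08/p29 — TAKING line HOME/STATUS.md 2026-08-22T00:48:57Z,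
notices in both seat INBOXes).  SKELETON rows **B11.Eq190** / **B11.Prop9** (cells; heads unchanged; r08 folds).  THE PRINT: (190) p. 308 and Prop. 9
p. 309 *«its functional derivative (182) satisfies the inequalities (190)»* — whose bracket `[(L^jη)^{−1}, (L^jη)^{−2}, …]` lists the COVARIANT-
DERIVATIVE entries this file serves (quoted in `B11Ineq190Actual`/`B11Ineq190ActualDeriv`); Prop. 3 p. 289, (44) p. 285 *«The Proposition 4 of [4]
implies Q_j(ηA) = L^jηQ_jA + C_j(L^jηA), |C_j(L^jηA)| ≦ C₂(L^jη)²|A|²»* (v1.2, r12 gen 19, `lit-balaban-r12/QUOTE-AUDIT-B15.md` finding A8: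
this quotation restored from the page image — v1/v1.1 carried the unprinted words «implies that it is an analytic function of A»; docstring
only, no declaration, statement or proof changed), (72)/(73) p. 289 (quoted in `B11Prop3Concrete`, `B11Eq73KernelConcrete`, `B11Ineq73HasMajConcrete`).

WHAT THIS FILE PROVES (kernel-checked, 0 sorry, standard axioms; theorems only — no `def`, no new `Prop`, no named fact).  For EACH of p29's two
first-order output sizes — `covDerivBlockSize g y₀ Sc ξ Uc` (*«and its covariant derivatives»*) and the weighted `ofSeminorms g y₀ (cw • covDerivSize
(Sc ·) ξ Uc)` (print's weights `(L^iη)`, `(L^{j+1}η)` of [IV] (1.45)/(1.57)) — the three levels of r08's sup-size chain, verbatim his pattern: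
§1 `ineq190_and_hmv_covDerivBlockSize_of_inputs`, `ineq190_and_hmv_ofSeminorms_of_inputs` — p29's sectG theorems with the Sect. C letters `hTm`
   (analyticity of `Tm = · − H(Dfix ·)` on `‖Y‖ < ε₄ + a`), `hTm0` (`Tm 0 = 0`) and the differentiability half of `hDfr` DISCHARGED from Prop. 3's
   `Inputs C H C₂ C₃ B₀′ c₄` + analyticity of `C` + the Prop. 3 smallness + `ε₄ + a ≤ ε₃` (`B11Ineq190FromProp3` §1); the letter left for `𝔇` is the
   (73)-majorant `h73` of the ACTUAL derivative of `Dfix` at the points of the (180) domain.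
§2 `ineq190_and_hmv_covDerivBlockSize_concreteC`, `ineq190_and_hmv_ofSeminorms_concreteC` — §1 at the CONCRETE remainder `C := Cmap L U₀ S T j` of [4]
   on `ℤᵈ` (`Inputs` = `B11Prop3Concrete.inputs_concrete`, analyticity = `B12SecondOrder267Concrete.analyticOnNhd_Cmap`, smallness in tree units via
   `B11Prop3Concrete.smallness_concrete`), exactly as `B11Ineq190ConcreteC`.
§3 `ineq190_and_hmv_covDerivBlockSize_concreteC_kernel`, `ineq190_and_hmv_ofSeminorms_concreteC_kernel` — §2 on r08's SINGLE-SCALE CUBE GEOMETRY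
   `cubeGeometry L j S T` with the sup sizes of the fine / coarse bonds as `bN` / `bB`, the (73)-majorant DISCHARGED from the H-kernel letter `hHker`
   (`B11Ineq73HasMajConcrete.hasMaj_fderiv_Dfix` at `ε := ε₃`, the points lying in the `ε₃`-ball by `norm_arg180_lt_eps3`), and `hN`, `hBloc`, (2.54)
   `htri`, `hd`, (2.61) `hrow` (rate `⅛δ₀`, constant `c₀(δ₀,⅛)ᵈ`) ALL DISCHARGED, exactly as `B11Ineq73HasMajConcrete` §4.
HONEST SCOPE.  Pure composition of landed theorems BY NAME (p29 `B11Ineq190ActualDeriv` p306169; r08 `B11Ineq190FromProp3` p305181, `B11Prop3Concrete`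
p303798, `B11Ineq73HasMajConcrete` p309726; p06 `B11Eq73KernelConcrete`, `B12SecondOrder267Concrete`); nothing of [5]/[6] constructed (`G̃`, `W`, `Δ⁽²⁾`,
`H₀`, `H` abstract on the concrete carriers `𝔸^S`/`𝔸^T`); single scale `Λ_j` (r08's scope); the first-order output size, its index sets `Sc`, step
`ξ` and transport background `Uc`, and the presentation `ev` with its compatibility letter `hP` are parameters (the instantiation of `𝒴` as the
space (115) is p29's `B11MeanValue190Lattice`); NOT summit progress.  Re-declares nothing; no new named fact (net debt delta 0).
v1.1 (r12 gen 14, 2026-08-22): CITELOC DOCFIX ONLY — the four locators «(115) p.295» now read «(115) p.294» (display (115) is the last display of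
p. 294 = PDF 18 l. 34 of [Balaban1985Variational]; (117) opens p. 295; r08 gen-13 citeloc sweep, re-read on the text layer by this seat); no
declaration, statement or proof changed.
-/

noncomputable section

namespace Literature.MathematicalPhysics.QuantumFieldTheory.Balaban1983to89.B11Ineq190DerivConcreteC

open Literature.MathematicalPhysics.QuantumFieldTheory.Balaban1983to89
open B7Prop1Explicit B7Prop1Local B7Prop2Explicit B7Prop3Flat B7Prop4Flat B7Eq92Concrete B7Prop3GeneralLinear
  B7Prop4GeneralLevels B7Prop5GeneralOperators B7Prop5GeneralInduction B7Prop5GeneralLevels B7Prop5General B7Ineq149Pairing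
  B13Contraction113 B11SectG B11Eq174Chart B11Eq183Differentiation B11Presentation190 B11SupSize190 B11SeminormSize190
  B11Ineq190Actual B11Ineq190ActualDeriv B11Ineq190FromProp3 B11Prop3Model B11Ineq73HasMajConcrete B6RandomWalk Set Metric
open scoped NNReal

-- the `ℤ^d` sites of `B7Prop1Explicit` are written `B7Prop1Explicit.Site` (the bare name would resolve to the torus sites of `Setup.lean`).

/-! ## §1 The first-order sizes with the Sect. C letters from Proposition 3 -/

section OfInputs

variable {𝒳 𝒴 𝒵 : Type} [NormedAddCommGroup 𝒳] [NormedSpace ℂ 𝒳] [NormedAddCommGroup 𝒴] [NormedSpace ℂ 𝒴]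
  [NormedAddCommGroup 𝒵] [NormedSpace ℂ 𝒵] [CompleteSpace 𝒳] [CompleteSpace 𝒴] [CompleteSpace 𝒵]
  {𝒢 : 𝒵 →L[ℂ] 𝒴} {W : 𝒴 → 𝒵} {D2 : 𝒴 →L[ℂ] 𝒵} {H₀ : 𝒳 →L[ℂ] 𝒴} {B₀ θ C₄ a₃ j a ε₄ : ℝ}
  {C : 𝒴 → 𝒳} {H : 𝒳 →L[ℂ] 𝒴} {C₂ C₃ B₀' c₄ ε₃ : ℝ} {g : B6.Geometry}
  {d : ℕ} {𝔸 : Type} [NormedRing 𝔸] [NormedAlgebra ℂ 𝔸]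
  {y₀ : g.Site} {Sc : g.Site → Finset (B7Prop1Explicit.Site d × Fin d × Fin d)} {ξ : ℝ}
  {Uc : B7Prop1Explicit.Site d → Fin d → 𝔸ˣ}

/-- **END TO END FOR `covDerivBlockSize` with the Sect. C letters from Proposition 3** — p29's
`B11Ineq190ActualDeriv.ineq190_and_hmv_covDerivBlockSize_sectG` with `Tm := Y ↦ Y − H(Dfix C H C₂ Y)`: `hTm`, `hTm0` and the differentiability half
of `hDfr` DISCHARGED from `Inputs C H C₂ C₃ B₀′ c₄` ((44)/(46)/(72)), `AnalyticOnNhd ℂ C {‖Y‖ < 2c₄}`, the Prop. 3 smallness (`18C₂B₀′ε₃ ≤ 1`,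
`2ε₃ ≤ c₄`) and `ε₄ + a ≤ ε₃` (the sup-size twin is r08's `ineq190_and_hmv_supSize_of_inputs`). [cite: Balaban1985Variational, Prop. 9 (190) pp.308–309, Prop. 3 p.289, (179)–(180) p.306, (115) p.294] -/
theorem ineq190_and_hmv_covDerivBlockSize_of_inputs (R : Regime 𝒢 0 W B₀ θ C₄ a₃ j a ε₄)
    (hWa : AnalyticOnNhd ℂ W {Y : 𝒴 | ‖Y‖ < a₃})
    (hin : Inputs C (H : 𝒳 →ₗ[ℂ] 𝒴) C₂ C₃ B₀' c₄) (hCa : AnalyticOnNhd ℂ C {Y : 𝒴 | ‖Y‖ < 2 * c₄})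
    (hC₂ : 0 ≤ C₂) (hC₃ : 0 ≤ C₃) (hB₀' : 0 ≤ B₀') (hε₃ : 0 < ε₃) (h18 : 18 * C₂ * B₀' * ε₃ ≤ 1) (h2 : 2 * ε₃ ≤ c₄)
    (hnest : ε₄ + a ≤ ε₃)
    {B : 𝒳} (hB : ‖H₀ B‖ < a ∧ ‖D2 (H₀ B)‖ < j) (ev : B7Prop1Explicit.Site d → (𝒴 →L[ℝ] (Fin d → 𝔸)))
    {bB : BlockNorm g 𝒳} {bN : BlockNorm g 𝒴} {b3 : BlockNorm g 𝒵}
    (hP : ∀ (y : g.Site) (v : 𝒴), (covDerivBlockSize g y₀ Sc ξ Uc).loc y (fun x => ev x v) ≤ bN.loc y v)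
    (hN : ∀ (y : g.Site) (v : 𝒴), bN.loc y v ≤ ‖v‖) (hBloc : ∀ (y' : g.Site) (μ : 𝒳), bB.IsLoc y' μ → ‖μ‖ ≤ bB.loc y' μ)
    {δ₀ BG θW cΔ A₀ AH θD c : ℝ}
    (htri : Triangle254 g) (hd : ∀ a b : g.Site, 0 ≤ g.dist a b) (hδ₀ : 0 ≤ δ₀) (hrow : RowSum g (δ₀ / 8) c)
    (hc : 0 ≤ c) (hBG : 0 ≤ BG) (hθW : 0 ≤ θW) (hcΔ : 0 ≤ cΔ) (hA₀ : 0 ≤ A₀) (hAH : 0 ≤ AH) (hθD : 0 ≤ θD)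
    (hG : HasMaj b3 bN (𝒢.restrictScalars ℝ : 𝒵 →ₗ[ℝ] 𝒴) (fun y y' => BG * Real.exp (-(δ₀ * g.dist y y'))))
    (hD2H0 : HasMaj bB b3 ((D2 ∘L H₀).restrictScalars ℝ : 𝒳 →ₗ[ℝ] 𝒵) (fun y y' => cΔ * Real.exp (-(δ₀ * g.dist y y'))))
    (hH0 : HasMaj bB bN (H₀.restrictScalars ℝ : 𝒳 →ₗ[ℝ] 𝒴) (fun y y' => A₀ * Real.exp (-(δ₀ * g.dist y y'))))
    (hH : HasMaj bB bN (H.restrictScalars ℝ : 𝒳 →ₗ[ℝ] 𝒴) (fun y y' => AH * Real.exp (-(δ₀ / 2 * g.dist y y'))))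
    (h189 : ∀ B' : 𝒳, ‖H₀ B'‖ < a → ‖D2 (H₀ B')‖ < j →
      Ineq189 bN b3 ((fderiv ℂ W (solA180 𝒢 W D2 H₀ ε₄ B' + H₀ B')).restrictScalars ℝ : 𝒴 →ₗ[ℝ] 𝒵) θW δ₀)
    (h73 : ∀ B' : 𝒳, ‖H₀ B'‖ < a → ‖D2 (H₀ B')‖ < j →
      HasMaj bN bB ((fderiv ℂ (Dfix C (H : 𝒳 →ₗ[ℂ] 𝒴) C₂) (solA180 𝒢 W D2 H₀ ε₄ B' + H₀ B')).restrictScalars ℝ : 𝒴 →ₗ[ℝ] 𝒳)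
        (fun y y' => θD * Real.exp (-(δ₀ / 2 * g.dist y y'))))
    (hq : qG b3.κ bN.κ BG θW c < 1)
    (Hl : 𝒳 → B7Prop1Explicit.Site d → Fin d → 𝔸) (dH : Icc (0:ℝ) 1 → 𝒳 →ₗ[ℝ] (B7Prop1Explicit.Site d → Fin d → 𝔸))
    (hHl : ∀ B' : 𝒳, Hl B' = fun x => ev x (chartH179 𝒢 W D2 H₀ (fun Y : 𝒴 => Y - H (Dfix C (H : 𝒳 →ₗ[ℂ] 𝒴) C₂ Y)) ε₄ B'))
    (hdH : ∀ t : Icc (0:ℝ) 1, dH t =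
      (LinearMap.pi fun x => ((ev x : 𝒴 →L[ℝ] (Fin d → 𝔸)) : 𝒴 →ₗ[ℝ] (Fin d → 𝔸))) ∘ₗ
        ((fderiv ℂ (chartH179 𝒢 W D2 H₀ (fun Y : 𝒴 => Y - H (Dfix C (H : 𝒳 →ₗ[ℂ] 𝒴) C₂ Y)) ε₄) ((t : ℝ) • B)).restrictScalars ℝ :
          𝒳 →ₗ[ℝ] 𝒴))
    (y : g.Site) :
    (∀ t : Icc (0:ℝ) 1, Ineq190 bB (covDerivBlockSize g y₀ Sc ξ Uc) (dH t) (const190 bB.κ bN.κ b3.κ BG θW cΔ A₀ AH θD c) δ₀) ∧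
      ∀ s : ℝ, (∀ t, (covDerivBlockSize g y₀ Sc ξ Uc).loc y (dH t B) ≤ s) → (covDerivBlockSize g y₀ Sc ξ Uc).loc y (Hl B) ≤ s :=
  ineq190_and_hmv_covDerivBlockSize_sectG R hWa H (analyticOnNhd_Tm_of_le hin hCa hC₂ hB₀' hε₃ h18 h2 hnest)
    (Tm_zero hin hC₂ hB₀' hε₃ h18 h2) hB ev hP hN hBloc htri hd hδ₀ hrow hc hBG hθW hcΔ hA₀ hAH hθD hG hD2H0 hH0 hH h189
    (fun B' h𝔄 hJ => ⟨_, hasFDerivAt_Dfix_of_lt hin hC₂ hC₃ hB₀' hε₃ h18 h2 (norm_arg180_lt_eps3 R hJ h𝔄 hnest),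
      h73 B' h𝔄 hJ⟩) hq Hl dH hHl hdH y

/-- **END TO END FOR THE WEIGHTED FIRST-ORDER SIZE `ofSeminorms g y₀ (cw • covDerivSize …)` with the Sect. C letters from Proposition 3** — p29's
`B11Ineq190ActualDeriv.ineq190_and_hmv_ofSeminorms_sectG` with `Tm := Y ↦ Y − H(Dfix C H C₂ Y)`, the three Sect. C letters DISCHARGED as above.
[cite: Balaban1985Variational, Prop. 9 (190) pp.308–309, Prop. 3 p.289, (179)–(180) p.306, (115) p.294] -/
theorem ineq190_and_hmv_ofSeminorms_of_inputs (R : Regime 𝒢 0 W B₀ θ C₄ a₃ j a ε₄)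
    (hWa : AnalyticOnNhd ℂ W {Y : 𝒴 | ‖Y‖ < a₃})
    (hin : Inputs C (H : 𝒳 →ₗ[ℂ] 𝒴) C₂ C₃ B₀' c₄) (hCa : AnalyticOnNhd ℂ C {Y : 𝒴 | ‖Y‖ < 2 * c₄})
    (hC₂ : 0 ≤ C₂) (hC₃ : 0 ≤ C₃) (hB₀' : 0 ≤ B₀') (hε₃ : 0 < ε₃) (h18 : 18 * C₂ * B₀' * ε₃ ≤ 1) (h2 : 2 * ε₃ ≤ c₄)
    (hnest : ε₄ + a ≤ ε₃)
    {B : 𝒳} (hB : ‖H₀ B‖ < a ∧ ‖D2 (H₀ B)‖ < j) (ev : B7Prop1Explicit.Site d → (𝒴 →L[ℝ] (Fin d → 𝔸))) (cw : ℝ≥0)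
    {bB : BlockNorm g 𝒳} {bN : BlockNorm g 𝒴} {b3 : BlockNorm g 𝒵}
    (hP : ∀ (y : g.Site) (v : 𝒴), (ofSeminorms g y₀ (fun y => cw • covDerivSize (Sc y) ξ Uc)).loc y (fun x => ev x v) ≤ bN.loc y v)
    (hN : ∀ (y : g.Site) (v : 𝒴), bN.loc y v ≤ ‖v‖) (hBloc : ∀ (y' : g.Site) (μ : 𝒳), bB.IsLoc y' μ → ‖μ‖ ≤ bB.loc y' μ)
    {δ₀ BG θW cΔ A₀ AH θD c : ℝ}
    (htri : Triangle254 g) (hd : ∀ a b : g.Site, 0 ≤ g.dist a b) (hδ₀ : 0 ≤ δ₀) (hrow : RowSum g (δ₀ / 8) c)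
    (hc : 0 ≤ c) (hBG : 0 ≤ BG) (hθW : 0 ≤ θW) (hcΔ : 0 ≤ cΔ) (hA₀ : 0 ≤ A₀) (hAH : 0 ≤ AH) (hθD : 0 ≤ θD)
    (hG : HasMaj b3 bN (𝒢.restrictScalars ℝ : 𝒵 →ₗ[ℝ] 𝒴) (fun y y' => BG * Real.exp (-(δ₀ * g.dist y y'))))
    (hD2H0 : HasMaj bB b3 ((D2 ∘L H₀).restrictScalars ℝ : 𝒳 →ₗ[ℝ] 𝒵) (fun y y' => cΔ * Real.exp (-(δ₀ * g.dist y y'))))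
    (hH0 : HasMaj bB bN (H₀.restrictScalars ℝ : 𝒳 →ₗ[ℝ] 𝒴) (fun y y' => A₀ * Real.exp (-(δ₀ * g.dist y y'))))
    (hH : HasMaj bB bN (H.restrictScalars ℝ : 𝒳 →ₗ[ℝ] 𝒴) (fun y y' => AH * Real.exp (-(δ₀ / 2 * g.dist y y'))))
    (h189 : ∀ B' : 𝒳, ‖H₀ B'‖ < a → ‖D2 (H₀ B')‖ < j →
      Ineq189 bN b3 ((fderiv ℂ W (solA180 𝒢 W D2 H₀ ε₄ B' + H₀ B')).restrictScalars ℝ : 𝒴 →ₗ[ℝ] 𝒵) θW δ₀)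
    (h73 : ∀ B' : 𝒳, ‖H₀ B'‖ < a → ‖D2 (H₀ B')‖ < j →
      HasMaj bN bB ((fderiv ℂ (Dfix C (H : 𝒳 →ₗ[ℂ] 𝒴) C₂) (solA180 𝒢 W D2 H₀ ε₄ B' + H₀ B')).restrictScalars ℝ : 𝒴 →ₗ[ℝ] 𝒳)
        (fun y y' => θD * Real.exp (-(δ₀ / 2 * g.dist y y'))))
    (hq : qG b3.κ bN.κ BG θW c < 1)
    (Hl : 𝒳 → B7Prop1Explicit.Site d → Fin d → 𝔸) (dH : Icc (0:ℝ) 1 → 𝒳 →ₗ[ℝ] (B7Prop1Explicit.Site d → Fin d → 𝔸))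
    (hHl : ∀ B' : 𝒳, Hl B' = fun x => ev x (chartH179 𝒢 W D2 H₀ (fun Y : 𝒴 => Y - H (Dfix C (H : 𝒳 →ₗ[ℂ] 𝒴) C₂ Y)) ε₄ B'))
    (hdH : ∀ t : Icc (0:ℝ) 1, dH t =
      (LinearMap.pi fun x => ((ev x : 𝒴 →L[ℝ] (Fin d → 𝔸)) : 𝒴 →ₗ[ℝ] (Fin d → 𝔸))) ∘ₗ
        ((fderiv ℂ (chartH179 𝒢 W D2 H₀ (fun Y : 𝒴 => Y - H (Dfix C (H : 𝒳 →ₗ[ℂ] 𝒴) C₂ Y)) ε₄) ((t : ℝ) • B)).restrictScalars ℝ :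
          𝒳 →ₗ[ℝ] 𝒴))
    (y : g.Site) :
    (∀ t : Icc (0:ℝ) 1, Ineq190 bB (ofSeminorms g y₀ (fun y => cw • covDerivSize (Sc y) ξ Uc)) (dH t)
        (const190 bB.κ bN.κ b3.κ BG θW cΔ A₀ AH θD c) δ₀) ∧
      ∀ s : ℝ, (∀ t, (ofSeminorms g y₀ (fun y => cw • covDerivSize (Sc y) ξ Uc)).loc y (dH t B) ≤ s) →
        (ofSeminorms g y₀ (fun y => cw • covDerivSize (Sc y) ξ Uc)).loc y (Hl B) ≤ s :=
  ineq190_and_hmv_ofSeminorms_sectG R hWa H (analyticOnNhd_Tm_of_le hin hCa hC₂ hB₀' hε₃ h18 h2 hnest)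
    (Tm_zero hin hC₂ hB₀' hε₃ h18 h2) hB ev cw hP hN hBloc htri hd hδ₀ hrow hc hBG hθW hcΔ hA₀ hAH hθD hG hD2H0 hH0 hH h189
    (fun B' h𝔄 hJ => ⟨_, hasFDerivAt_Dfix_of_lt hin hC₂ hC₃ hB₀' hε₃ h18 h2 (norm_arg180_lt_eps3 R hJ h𝔄 hnest),
      h73 B' h𝔄 hJ⟩) hq Hl dH hHl hdH y

end OfInputs

/-! ## §2 At the concrete remainder `C_j(U₀, ·)` of [4] on `ℤᵈ` -/

section ConcreteC

variable {d : ℕ} {𝔸 : Type} [NormedRing 𝔸] [NormedAlgebra ℂ 𝔸] [CompleteSpace 𝔸] [NormOneClass 𝔸]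

variable (L : ℕ) (hL : 2 ≤ L) {G : Subgroup 𝔸ˣ} (hG : AvgClosed d L G) (k : ℕ)
  (U₀ : B7Prop1Explicit.Site d → Fin d → 𝔸ˣ) (hU₀ : ∀ x κ, U₀ x κ ∈ G) {α₀ : ℝ} (hα : 0 < α₀)
  (hα3 : C0 d * α₀ ≤ 1 / 3) (hα4 : 4 * α₀ ≤ c2' d L) (h52 : pdev U₀ < α₀ * (((L : ℝ) ^ k)⁻¹) ^ 2)
  {b : ℝ} (hb : 0 < b)
  (hsmall : Real.exp (4 * (800 * ((d : ℝ) + 1) ^ 2 * ((d : ℝ) + 4)) * α₀)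
    * (1 + 8 * (131072 * ((d : ℝ) + 1) ^ 2) * ((L : ℝ) ^ k * b)) ≤ 2)
  (hc₃ : 4 * ((L : ℝ) ^ k * b) < c3 d L)
  (h145 : 8 * d * thetaGen d L α₀ * (L : ℝ)⁻¹ ^ 4 ≤ 1)
  (h155 : (2 * (L : ℝ) - 1) * (L : ℝ)⁻¹ ^ 2 + 2 * d * thetaGen d L α₀ * (L : ℝ)⁻¹ ^ 3
    + 1 / 8 * (1 + 2 * d * thetaGen d L α₀ * (L : ℝ)⁻¹ ^ 2 + 2 * d * C3Gen d L * ((L : ℝ) ^ k * b)) * (L : ℝ)⁻¹ ^ 2 ≤ 1)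
  (S T : Finset (B7Prop1Explicit.Site d × Fin d))

variable {𝒵 : Type} [NormedAddCommGroup 𝒵] [NormedSpace ℂ 𝒵] [CompleteSpace 𝒵]
  {𝒢 : 𝒵 →L[ℂ] (S → 𝔸)} {W : (S → 𝔸) → 𝒵} {D2 : (S → 𝔸) →L[ℂ] 𝒵} {H₀ : (T → 𝔸) →L[ℂ] (S → 𝔸)} {B₀ θ C₄ a₃ jG a ε₄ : ℝ}
  {g : B6.Geometry} {y₀ : g.Site} {Sc : g.Site → Finset (B7Prop1Explicit.Site d × Fin d × Fin d)} {ξ : ℝ}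
  {Uc : B7Prop1Explicit.Site d → Fin d → 𝔸ˣ}

include hL hG hU₀ hα hα3 hα4 h52 hb hsmall hc₃ h145 h155 in
/-- **The end-to-end (190) chain for `covDerivBlockSize` with the Sect. C transformation CONCRETE** — §1 at `C := Cmap L U₀ S T j` (the remainder
`C_j(U₀, ·)` of [4] on `ℤᵈ`), `Inputs` supplied by `B11Prop3Concrete.inputs_concrete` ([4] Props 4/5 concretely) and the analyticity of `C` by
`B12SecondOrder267Concrete.analyticOnNhd_Cmap`; `H` abstract with (46); the Sect. G data abstract on `𝔸^S`/`𝔸^T` (the sup-size twin is r08's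
`B11Ineq190ConcreteC.ineq190_and_hmv_supSize_concreteC`). [cite: Balaban1985Variational, Prop. 9 (190) pp.308–309, Prop. 3 p.289, (44) p.285, (72) p.289]
[cite: Balaban1985Averaging, Prop. 4 p.38, Prop. 5 p.42] -/
theorem ineq190_and_hmv_covDerivBlockSize_concreteC {j : ℕ} (hj : j ≤ k) (hd1 : 1 ≤ d)
    (R : Regime 𝒢 0 W B₀ θ C₄ a₃ jG a ε₄) (hWa : AnalyticOnNhd ℂ W {Y : S → 𝔸 | ‖Y‖ < a₃})
    (H : (T → 𝔸) →L[ℂ] (S → 𝔸)) {B₀' : ℝ} (hB₀' : 0 ≤ B₀') (hH46 : ∀ X, ‖H X‖ ≤ B₀' * ‖X‖)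
    {c1h ε₃ : ℝ} (hc1h : 1 ≤ c1h) (hε₃ : 0 < ε₃)
    (h18 : 18 * ((8 * (131072 * ((d : ℝ) + 1) ^ 2) * Real.exp (4 * (800 * ((d : ℝ) + 1) ^ 2 * ((d : ℝ) + 4)) * α₀)) *
      ((L : ℝ) ^ j) ^ 2) * B₀' * d * c1h * ε₃ ≤ 1) (h2 : 2 * ε₃ ≤ b / 2) (hnest : ε₄ + a ≤ ε₃)
    {B : T → 𝔸} (hB : ‖H₀ B‖ < a ∧ ‖D2 (H₀ B)‖ < jG) (ev : B7Prop1Explicit.Site d → ((S → 𝔸) →L[ℝ] (Fin d → 𝔸)))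
    {bB : BlockNorm g (T → 𝔸)} {bN : BlockNorm g (S → 𝔸)} {b3 : BlockNorm g 𝒵}
    (hP : ∀ (y : g.Site) (v : S → 𝔸), (covDerivBlockSize g y₀ Sc ξ Uc).loc y (fun x => ev x v) ≤ bN.loc y v)
    (hN : ∀ (y : g.Site) (v : S → 𝔸), bN.loc y v ≤ ‖v‖)
    (hBloc : ∀ (y' : g.Site) (μ : T → 𝔸), bB.IsLoc y' μ → ‖μ‖ ≤ bB.loc y' μ)
    {δ₀ BG θW cΔ A₀ AH θD c : ℝ}
    (htri : Triangle254 g) (hd : ∀ a b : g.Site, 0 ≤ g.dist a b) (hδ₀ : 0 ≤ δ₀) (hrow : RowSum g (δ₀ / 8) c)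
    (hc : 0 ≤ c) (hBG : 0 ≤ BG) (hθW : 0 ≤ θW) (hcΔ : 0 ≤ cΔ) (hA₀ : 0 ≤ A₀) (hAH : 0 ≤ AH) (hθD : 0 ≤ θD)
    (hG190 : HasMaj b3 bN (𝒢.restrictScalars ℝ : 𝒵 →ₗ[ℝ] (S → 𝔸)) (fun y y' => BG * Real.exp (-(δ₀ * g.dist y y'))))
    (hD2H0 : HasMaj bB b3 ((D2 ∘L H₀).restrictScalars ℝ : (T → 𝔸) →ₗ[ℝ] 𝒵) (fun y y' => cΔ * Real.exp (-(δ₀ * g.dist y y'))))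
    (hH0 : HasMaj bB bN (H₀.restrictScalars ℝ : (T → 𝔸) →ₗ[ℝ] (S → 𝔸)) (fun y y' => A₀ * Real.exp (-(δ₀ * g.dist y y'))))
    (hH : HasMaj bB bN (H.restrictScalars ℝ : (T → 𝔸) →ₗ[ℝ] (S → 𝔸)) (fun y y' => AH * Real.exp (-(δ₀ / 2 * g.dist y y'))))
    (h189 : ∀ B' : T → 𝔸, ‖H₀ B'‖ < a → ‖D2 (H₀ B')‖ < jG →
      Ineq189 bN b3 ((fderiv ℂ W (solA180 𝒢 W D2 H₀ ε₄ B' + H₀ B')).restrictScalars ℝ : (S → 𝔸) →ₗ[ℝ] 𝒵) θW δ₀)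
    (h73 : ∀ B' : T → 𝔸, ‖H₀ B'‖ < a → ‖D2 (H₀ B')‖ < jG →
      HasMaj bN bB
        ((fderiv ℂ (Dfix (B11Eq44Concrete.Cmap L U₀ S T j) (H : (T → 𝔸) →ₗ[ℂ] (S → 𝔸))
          ((8 * (131072 * ((d : ℝ) + 1) ^ 2) * Real.exp (4 * (800 * ((d : ℝ) + 1) ^ 2 * ((d : ℝ) + 4)) * α₀)) * ((L : ℝ) ^ j) ^ 2))
          (solA180 𝒢 W D2 H₀ ε₄ B' + H₀ B')).restrictScalars ℝ : (S → 𝔸) →ₗ[ℝ] (T → 𝔸))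
        (fun y y' => θD * Real.exp (-(δ₀ / 2 * g.dist y y'))))
    (hq : qG b3.κ bN.κ BG θW c < 1)
    (Hl : (T → 𝔸) → B7Prop1Explicit.Site d → Fin d → 𝔸) (dH : Icc (0:ℝ) 1 → (T → 𝔸) →ₗ[ℝ] (B7Prop1Explicit.Site d → Fin d → 𝔸))
    (hHl : ∀ B' : T → 𝔸, Hl B' = fun x => ev x (chartH179 𝒢 W D2 H₀
      (fun Y : S → 𝔸 => Y - H (Dfix (B11Eq44Concrete.Cmap L U₀ S T j) (H : (T → 𝔸) →ₗ[ℂ] (S → 𝔸))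
        ((8 * (131072 * ((d : ℝ) + 1) ^ 2) * Real.exp (4 * (800 * ((d : ℝ) + 1) ^ 2 * ((d : ℝ) + 4)) * α₀)) * ((L : ℝ) ^ j) ^ 2) Y))
      ε₄ B'))
    (hdH : ∀ t : Icc (0:ℝ) 1, dH t = (LinearMap.pi fun x => ((ev x : (S → 𝔸) →L[ℝ] (Fin d → 𝔸)) : (S → 𝔸) →ₗ[ℝ] (Fin d → 𝔸))) ∘ₗ
      ((fderiv ℂ (chartH179 𝒢 W D2 H₀
        (fun Y : S → 𝔸 => Y - H (Dfix (B11Eq44Concrete.Cmap L U₀ S T j) (H : (T → 𝔸) →ₗ[ℂ] (S → 𝔸))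
          ((8 * (131072 * ((d : ℝ) + 1) ^ 2) * Real.exp (4 * (800 * ((d : ℝ) + 1) ^ 2 * ((d : ℝ) + 4)) * α₀)) * ((L : ℝ) ^ j) ^ 2) Y))
        ε₄) ((t : ℝ) • B)).restrictScalars ℝ : (T → 𝔸) →ₗ[ℝ] (S → 𝔸)))
    (y : g.Site) :
    (∀ t : Icc (0:ℝ) 1, Ineq190 bB (covDerivBlockSize g y₀ Sc ξ Uc) (dH t) (const190 bB.κ bN.κ b3.κ BG θW cΔ A₀ AH θD c) δ₀) ∧
      ∀ s : ℝ, (∀ t, (covDerivBlockSize g y₀ Sc ξ Uc).loc y (dH t B) ≤ s) → (covDerivBlockSize g y₀ Sc ξ Uc).loc y (Hl B) ≤ s := by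
  have hin := B11Prop3Concrete.inputs_concrete L hL hG k U₀ hU₀ hα hα3 hα4 h52 hb hsmall hc₃ h145 h155 S T
    (H : (T → 𝔸) →ₗ[ℂ] (S → 𝔸)) hj hH46
  have hCa : AnalyticOnNhd ℂ (B11Eq44Concrete.Cmap L U₀ S T j) {Y : S → 𝔸 | ‖Y‖ < 2 * (b / 2)} := by
    have h2b : {Y : S → 𝔸 | ‖Y‖ < 2 * (b / 2)} = {Y : S → 𝔸 | ‖Y‖ < b} := by
      ext Y; simp only [Set.mem_setOf_eq]; constructor <;> intro h <;> linarith
    rw [h2b]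
    exact B12SecondOrder267Concrete.analyticOnNhd_Cmap L hL hG k U₀ hU₀ hα hα3 hα4 h52 hb hsmall hc₃ S T hj
  have hdR : (1 : ℝ) ≤ (d : ℝ) := by exact_mod_cast hd1
  have hK : (0 : ℝ) ≤ (8 * (131072 * ((d : ℝ) + 1) ^ 2) * Real.exp (4 * (800 * ((d : ℝ) + 1) ^ 2 * ((d : ℝ) + 4)) * α₀)) *
      ((L : ℝ) ^ j) ^ 2 := by positivity
  have hC3 : (0 : ℝ) ≤ 2 * (d : ℝ) * (C3Gen d L * ((L : ℝ) ^ j) ^ 2) :=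
    mul_nonneg (by positivity) (mul_nonneg (by unfold C3Gen C1ppGen; positivity) (by positivity))
  obtain ⟨-, -, h18', -, -, -⟩ := B11Prop3Concrete.smallness_concrete hK hB₀' hε₃.le hdR hc1h hb h18 h2
  exact ineq190_and_hmv_covDerivBlockSize_of_inputs R hWa hin hCa hK hC3 hB₀' hε₃ h18' h2 hnest hB ev hP hN hBloc htri hd hδ₀
    hrow hc hBG hθW hcΔ hA₀ hAH hθD hG190 hD2H0 hH0 hH h189 h73 hq Hl dH hHl hdH y

include hL hG hU₀ hα hα3 hα4 h52 hb hsmall hc₃ h145 h155 in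
/-- **The end-to-end (190) chain for the weighted first-order size `ofSeminorms g y₀ (cw • covDerivSize …)` with the Sect. C transformation CONCRETE**
— as above, for p29's weighted size. [cite: Balaban1985Variational, Prop. 9 (190) pp.308–309, Prop. 3 p.289, (44) p.285, (72) p.289]
[cite: Balaban1985Averaging, Prop. 4 p.38, Prop. 5 p.42] -/
theorem ineq190_and_hmv_ofSeminorms_concreteC {j : ℕ} (hj : j ≤ k) (hd1 : 1 ≤ d)
    (R : Regime 𝒢 0 W B₀ θ C₄ a₃ jG a ε₄) (hWa : AnalyticOnNhd ℂ W {Y : S → 𝔸 | ‖Y‖ < a₃})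
    (H : (T → 𝔸) →L[ℂ] (S → 𝔸)) {B₀' : ℝ} (hB₀' : 0 ≤ B₀') (hH46 : ∀ X, ‖H X‖ ≤ B₀' * ‖X‖)
    {c1h ε₃ : ℝ} (hc1h : 1 ≤ c1h) (hε₃ : 0 < ε₃)
    (h18 : 18 * ((8 * (131072 * ((d : ℝ) + 1) ^ 2) * Real.exp (4 * (800 * ((d : ℝ) + 1) ^ 2 * ((d : ℝ) + 4)) * α₀)) *
      ((L : ℝ) ^ j) ^ 2) * B₀' * d * c1h * ε₃ ≤ 1) (h2 : 2 * ε₃ ≤ b / 2) (hnest : ε₄ + a ≤ ε₃)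
    {B : T → 𝔸} (hB : ‖H₀ B‖ < a ∧ ‖D2 (H₀ B)‖ < jG) (ev : B7Prop1Explicit.Site d → ((S → 𝔸) →L[ℝ] (Fin d → 𝔸))) (cw : ℝ≥0)
    {bB : BlockNorm g (T → 𝔸)} {bN : BlockNorm g (S → 𝔸)} {b3 : BlockNorm g 𝒵}
    (hP : ∀ (y : g.Site) (v : S → 𝔸),
      (ofSeminorms g y₀ (fun y => cw • covDerivSize (Sc y) ξ Uc)).loc y (fun x => ev x v) ≤ bN.loc y v)
    (hN : ∀ (y : g.Site) (v : S → 𝔸), bN.loc y v ≤ ‖v‖)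
    (hBloc : ∀ (y' : g.Site) (μ : T → 𝔸), bB.IsLoc y' μ → ‖μ‖ ≤ bB.loc y' μ)
    {δ₀ BG θW cΔ A₀ AH θD c : ℝ}
    (htri : Triangle254 g) (hd : ∀ a b : g.Site, 0 ≤ g.dist a b) (hδ₀ : 0 ≤ δ₀) (hrow : RowSum g (δ₀ / 8) c)
    (hc : 0 ≤ c) (hBG : 0 ≤ BG) (hθW : 0 ≤ θW) (hcΔ : 0 ≤ cΔ) (hA₀ : 0 ≤ A₀) (hAH : 0 ≤ AH) (hθD : 0 ≤ θD)
    (hG190 : HasMaj b3 bN (𝒢.restrictScalars ℝ : 𝒵 →ₗ[ℝ] (S → 𝔸)) (fun y y' => BG * Real.exp (-(δ₀ * g.dist y y'))))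
    (hD2H0 : HasMaj bB b3 ((D2 ∘L H₀).restrictScalars ℝ : (T → 𝔸) →ₗ[ℝ] 𝒵) (fun y y' => cΔ * Real.exp (-(δ₀ * g.dist y y'))))
    (hH0 : HasMaj bB bN (H₀.restrictScalars ℝ : (T → 𝔸) →ₗ[ℝ] (S → 𝔸)) (fun y y' => A₀ * Real.exp (-(δ₀ * g.dist y y'))))
    (hH : HasMaj bB bN (H.restrictScalars ℝ : (T → 𝔸) →ₗ[ℝ] (S → 𝔸)) (fun y y' => AH * Real.exp (-(δ₀ / 2 * g.dist y y'))))
    (h189 : ∀ B' : T → 𝔸, ‖H₀ B'‖ < a → ‖D2 (H₀ B')‖ < jG →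
      Ineq189 bN b3 ((fderiv ℂ W (solA180 𝒢 W D2 H₀ ε₄ B' + H₀ B')).restrictScalars ℝ : (S → 𝔸) →ₗ[ℝ] 𝒵) θW δ₀)
    (h73 : ∀ B' : T → 𝔸, ‖H₀ B'‖ < a → ‖D2 (H₀ B')‖ < jG →
      HasMaj bN bB
        ((fderiv ℂ (Dfix (B11Eq44Concrete.Cmap L U₀ S T j) (H : (T → 𝔸) →ₗ[ℂ] (S → 𝔸))
          ((8 * (131072 * ((d : ℝ) + 1) ^ 2) * Real.exp (4 * (800 * ((d : ℝ) + 1) ^ 2 * ((d : ℝ) + 4)) * α₀)) * ((L : ℝ) ^ j) ^ 2))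
          (solA180 𝒢 W D2 H₀ ε₄ B' + H₀ B')).restrictScalars ℝ : (S → 𝔸) →ₗ[ℝ] (T → 𝔸))
        (fun y y' => θD * Real.exp (-(δ₀ / 2 * g.dist y y'))))
    (hq : qG b3.κ bN.κ BG θW c < 1)
    (Hl : (T → 𝔸) → B7Prop1Explicit.Site d → Fin d → 𝔸) (dH : Icc (0:ℝ) 1 → (T → 𝔸) →ₗ[ℝ] (B7Prop1Explicit.Site d → Fin d → 𝔸))
    (hHl : ∀ B' : T → 𝔸, Hl B' = fun x => ev x (chartH179 𝒢 W D2 H₀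
      (fun Y : S → 𝔸 => Y - H (Dfix (B11Eq44Concrete.Cmap L U₀ S T j) (H : (T → 𝔸) →ₗ[ℂ] (S → 𝔸))
        ((8 * (131072 * ((d : ℝ) + 1) ^ 2) * Real.exp (4 * (800 * ((d : ℝ) + 1) ^ 2 * ((d : ℝ) + 4)) * α₀)) * ((L : ℝ) ^ j) ^ 2) Y))
      ε₄ B'))
    (hdH : ∀ t : Icc (0:ℝ) 1, dH t = (LinearMap.pi fun x => ((ev x : (S → 𝔸) →L[ℝ] (Fin d → 𝔸)) : (S → 𝔸) →ₗ[ℝ] (Fin d → 𝔸))) ∘ₗ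
      ((fderiv ℂ (chartH179 𝒢 W D2 H₀
        (fun Y : S → 𝔸 => Y - H (Dfix (B11Eq44Concrete.Cmap L U₀ S T j) (H : (T → 𝔸) →ₗ[ℂ] (S → 𝔸))
          ((8 * (131072 * ((d : ℝ) + 1) ^ 2) * Real.exp (4 * (800 * ((d : ℝ) + 1) ^ 2 * ((d : ℝ) + 4)) * α₀)) * ((L : ℝ) ^ j) ^ 2) Y))
        ε₄) ((t : ℝ) • B)).restrictScalars ℝ : (T → 𝔸) →ₗ[ℝ] (S → 𝔸)))
    (y : g.Site) :
    (∀ t : Icc (0:ℝ) 1, Ineq190 bB (ofSeminorms g y₀ (fun y => cw • covDerivSize (Sc y) ξ Uc)) (dH t)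
        (const190 bB.κ bN.κ b3.κ BG θW cΔ A₀ AH θD c) δ₀) ∧
      ∀ s : ℝ, (∀ t, (ofSeminorms g y₀ (fun y => cw • covDerivSize (Sc y) ξ Uc)).loc y (dH t B) ≤ s) →
        (ofSeminorms g y₀ (fun y => cw • covDerivSize (Sc y) ξ Uc)).loc y (Hl B) ≤ s := by
  have hin := B11Prop3Concrete.inputs_concrete L hL hG k U₀ hU₀ hα hα3 hα4 h52 hb hsmall hc₃ h145 h155 S T
    (H : (T → 𝔸) →ₗ[ℂ] (S → 𝔸)) hj hH46
  have hCa : AnalyticOnNhd ℂ (B11Eq44Concrete.Cmap L U₀ S T j) {Y : S → 𝔸 | ‖Y‖ < 2 * (b / 2)} := by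
    have h2b : {Y : S → 𝔸 | ‖Y‖ < 2 * (b / 2)} = {Y : S → 𝔸 | ‖Y‖ < b} := by
      ext Y; simp only [Set.mem_setOf_eq]; constructor <;> intro h <;> linarith
    rw [h2b]
    exact B12SecondOrder267Concrete.analyticOnNhd_Cmap L hL hG k U₀ hU₀ hα hα3 hα4 h52 hb hsmall hc₃ S T hj
  have hdR : (1 : ℝ) ≤ (d : ℝ) := by exact_mod_cast hd1
  have hK : (0 : ℝ) ≤ (8 * (131072 * ((d : ℝ) + 1) ^ 2) * Real.exp (4 * (800 * ((d : ℝ) + 1) ^ 2 * ((d : ℝ) + 4)) * α₀)) *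
      ((L : ℝ) ^ j) ^ 2 := by positivity
  have hC3 : (0 : ℝ) ≤ 2 * (d : ℝ) * (C3Gen d L * ((L : ℝ) ^ j) ^ 2) :=
    mul_nonneg (by positivity) (mul_nonneg (by unfold C3Gen C1ppGen; positivity) (by positivity))
  obtain ⟨-, -, h18', -, -, -⟩ := B11Prop3Concrete.smallness_concrete hK hB₀' hε₃.le hdR hc1h hb h18 h2
  exact ineq190_and_hmv_ofSeminorms_of_inputs R hWa hin hCa hK hC3 hB₀' hε₃ h18' h2 hnest hB ev cw hP hN hBloc htri hd hδ₀
    hrow hc hBG hθW hcΔ hA₀ hAH hθD hG190 hD2H0 hH0 hH h189 h73 hq Hl dH hHl hdH y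

end ConcreteC

/-! ## §3 On the single-scale cube geometry with the (73)-letter discharged -/

section Kernel

variable {d : ℕ} {𝔸 : Type} [NormedRing 𝔸] [NormedAlgebra ℂ 𝔸] [CompleteSpace 𝔸] [NormOneClass 𝔸]

variable (L : ℕ) (hL : 2 ≤ L) {G : Subgroup 𝔸ˣ} (hG : AvgClosed d L G) (k : ℕ)
  (U₀ : B7Prop1Explicit.Site d → Fin d → 𝔸ˣ) (hU₀ : ∀ x κ, U₀ x κ ∈ G) {α₀ : ℝ} (hα : 0 < α₀)
  (hα3 : C0 d * α₀ ≤ 1 / 3) (hα4 : 4 * α₀ ≤ c2' d L) (h52 : pdev U₀ < α₀ * (((L : ℝ) ^ k)⁻¹) ^ 2)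
  {b : ℝ} (hb : 0 < b)
  (hsmall : Real.exp (4 * (800 * ((d : ℝ) + 1) ^ 2 * ((d : ℝ) + 4)) * α₀)
    * (1 + 8 * (131072 * ((d : ℝ) + 1) ^ 2) * ((L : ℝ) ^ k * b)) ≤ 2)
  (hc₃ : 4 * ((L : ℝ) ^ k * b) < c3 d L)
  (h145 : 8 * d * thetaGen d L α₀ * (L : ℝ)⁻¹ ^ 4 ≤ 1)
  (h155 : (2 * (L : ℝ) - 1) * (L : ℝ)⁻¹ ^ 2 + 2 * d * thetaGen d L α₀ * (L : ℝ)⁻¹ ^ 3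
    + 1 / 8 * (1 + 2 * d * thetaGen d L α₀ * (L : ℝ)⁻¹ ^ 2 + 2 * d * C3Gen d L * ((L : ℝ) ^ k * b)) * (L : ℝ)⁻¹ ^ 2 ≤ 1)
  (S T : Finset (B7Prop1Explicit.Site d × Fin d))

variable {𝒵 : Type} [NormedAddCommGroup 𝒵] [NormedSpace ℂ 𝒵] [CompleteSpace 𝒵]
  {𝒢 : 𝒵 →L[ℂ] (S → 𝔸)} {W : (S → 𝔸) → 𝒵} {D2 : (S → 𝔸) →L[ℂ] 𝒵} {H₀ : (T → 𝔸) →L[ℂ] (S → 𝔸)} {B₀ θ C₄ a₃ jG a ε₄ : ℝ}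
  {ξ : ℝ} {Uc : B7Prop1Explicit.Site d → Fin d → 𝔸ˣ}

include hL hG hU₀ hα hα3 hα4 h52 hb hsmall hc₃ h145 h155 in
/-- **THE END-TO-END (190) CHAIN FOR `covDerivBlockSize` AT THE CONCRETE `C_j` ON THE CUBE GEOMETRY, (73)-LETTER DISCHARGED** — §2 with `g :=`
the single-scale cube geometry of `(S, T)`, `bN`, `bB :=` the sup sizes of the fine / coarse bonds, and the letters `h73` (from the H-kernel letter
`hHker` by `B11Ineq73HasMajConcrete.hasMaj_fderiv_Dfix` at `ε := ε₃`), `hN`, `hBloc`, `htri`, `hd`, `hrow` (rate `⅛δ₀`, `c = c₀(δ₀,⅛)ᵈ`) ALL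
DISCHARGED (the sup-size twin is r08's `B11Ineq73HasMajConcrete.ineq190_and_hmv_supSize_concreteC_kernel`).  Hypotheses left: the located leaves for
the ABSTRACT Sect. G data on the cube sizes ((189) `h189`, kernel letters of `G̃`/`Δ⁽²⁾H₀`/`H₀`/`H`, `q_G < 1`), `hHker` + `hq`, `Regime`,
`W`-analyticity, (46), the Prop. 3 smallness in tree units, and the first-order size's compatibility letter `hP`.
[cite: Balaban1985Variational, Prop. 9 (190) pp.308–309, (73) p.289, Prop. 3 p.289, (115) p.294] [cite: Balaban1984PropagatorsII, Lemma 2.1 (2.61) p.234, (2.54) p.233] -/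
theorem ineq190_and_hmv_covDerivBlockSize_concreteC_kernel {j : ℕ} (hj : j ≤ k) (hd1 : 1 ≤ d)
    (R : Regime 𝒢 0 W B₀ θ C₄ a₃ jG a ε₄) (hWa : AnalyticOnNhd ℂ W {Y : S → 𝔸 | ‖Y‖ < a₃})
    (H : (T → 𝔸) →L[ℂ] (S → 𝔸)) {B₀' : ℝ} (hB₀' : 0 ≤ B₀') (hH46 : ∀ X, ‖H X‖ ≤ B₀' * ‖X‖)
    {c1h ε₃ : ℝ} (hc1h : 1 ≤ c1h) (hε₃ : 0 < ε₃)
    (h18 : 18 * ((8 * (131072 * ((d : ℝ) + 1) ^ 2) * Real.exp (4 * (800 * ((d : ℝ) + 1) ^ 2 * ((d : ℝ) + 4)) * α₀)) *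
      ((L : ℝ) ^ j) ^ 2) * B₀' * d * c1h * ε₃ ≤ 1) (h2 : 2 * ε₃ ≤ b / 2) (hnest : ε₄ + a ≤ ε₃)
    {δ₀ B₁ : ℝ} (hδ₀ : 0 < δ₀) (hB₁ : 0 ≤ B₁)
    (hHker : ∀ (c'' : T) (Y : 𝔸) (s : S),
      ‖H (Pi.single c'' Y) s‖ ≤ B₁ * Real.exp (-(δ₀ * ((B7Prop1Explicit.l1 (loK L j c''.1.1 - s.1.1) : ℝ) / (L : ℝ) ^ j))) * ‖Y‖)
    (hq : (C3Gen d L * (((L : ℝ) ^ j) ^ 2 * (2 * ε₃)) * (2 * d) * B₁ * Real.exp (2 * d * δ₀)) * (d * B6.c0 δ₀ (1 / 2) ^ d) < 1)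
    {B : T → 𝔸} (hB : ‖H₀ B‖ < a ∧ ‖D2 (H₀ B)‖ < jG)
    (y₀ : (cubeGeometry L j S T).Site) (Sc : (cubeGeometry L j S T).Site → Finset (B7Prop1Explicit.Site d × Fin d × Fin d))
    (ev : B7Prop1Explicit.Site d → ((S → 𝔸) →L[ℝ] (Fin d → 𝔸))) {b3 : BlockNorm (cubeGeometry L j S T) 𝒵}
    (hP : ∀ (y : (cubeGeometry L j S T).Site) (v : S → 𝔸),
      (covDerivBlockSize (cubeGeometry L j S T) y₀ Sc ξ Uc).loc y (fun x => ev x v) ≤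
        (supSize (cubeGeometry L j S T) (boxS L j S T) (blkS L j S T) : BlockNorm (cubeGeometry L j S T) (S → 𝔸)).loc y v)
    {BG θW cΔ A₀ AH : ℝ} (hBG : 0 ≤ BG) (hθW : 0 ≤ θW) (hcΔ : 0 ≤ cΔ) (hA₀ : 0 ≤ A₀) (hAH : 0 ≤ AH)
    (hG190 : HasMaj b3 (supSize (cubeGeometry L j S T) (boxS L j S T) (blkS L j S T) : BlockNorm (cubeGeometry L j S T) (S → 𝔸))
      (𝒢.restrictScalars ℝ : 𝒵 →ₗ[ℝ] (S → 𝔸)) (fun y y' => BG * Real.exp (-(δ₀ * (cubeGeometry L j S T).dist y y'))))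
    (hD2H0 : HasMaj (supSize (cubeGeometry L j S T) (boxT L j S T) (blkT L j S T) : BlockNorm (cubeGeometry L j S T) (T → 𝔸)) b3
      ((D2 ∘L H₀).restrictScalars ℝ : (T → 𝔸) →ₗ[ℝ] 𝒵) (fun y y' => cΔ * Real.exp (-(δ₀ * (cubeGeometry L j S T).dist y y'))))
    (hH0 : HasMaj (supSize (cubeGeometry L j S T) (boxT L j S T) (blkT L j S T) : BlockNorm (cubeGeometry L j S T) (T → 𝔸))
      (supSize (cubeGeometry L j S T) (boxS L j S T) (blkS L j S T) : BlockNorm (cubeGeometry L j S T) (S → 𝔸))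
      (H₀.restrictScalars ℝ : (T → 𝔸) →ₗ[ℝ] (S → 𝔸)) (fun y y' => A₀ * Real.exp (-(δ₀ * (cubeGeometry L j S T).dist y y'))))
    (hH : HasMaj (supSize (cubeGeometry L j S T) (boxT L j S T) (blkT L j S T) : BlockNorm (cubeGeometry L j S T) (T → 𝔸))
      (supSize (cubeGeometry L j S T) (boxS L j S T) (blkS L j S T) : BlockNorm (cubeGeometry L j S T) (S → 𝔸))
      (H.restrictScalars ℝ : (T → 𝔸) →ₗ[ℝ] (S → 𝔸)) (fun y y' => AH * Real.exp (-(δ₀ / 2 * (cubeGeometry L j S T).dist y y'))))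
    (h189 : ∀ B' : T → 𝔸, ‖H₀ B'‖ < a → ‖D2 (H₀ B')‖ < jG →
      Ineq189 (supSize (cubeGeometry L j S T) (boxS L j S T) (blkS L j S T) : BlockNorm (cubeGeometry L j S T) (S → 𝔸)) b3
        ((fderiv ℂ W (solA180 𝒢 W D2 H₀ ε₄ B' + H₀ B')).restrictScalars ℝ : (S → 𝔸) →ₗ[ℝ] 𝒵) θW δ₀)
    (hqG : qG b3.κ 1 BG θW (B6.c0 δ₀ (1 / 8) ^ d) < 1)
    (Hl : (T → 𝔸) → B7Prop1Explicit.Site d → Fin d → 𝔸) (dH : Icc (0:ℝ) 1 → (T → 𝔸) →ₗ[ℝ] (B7Prop1Explicit.Site d → Fin d → 𝔸))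
    (hHl : ∀ B' : T → 𝔸, Hl B' = fun x => ev x (chartH179 𝒢 W D2 H₀
      (fun Y : S → 𝔸 => Y - H (Dfix (B11Eq44Concrete.Cmap L U₀ S T j) (H : (T → 𝔸) →ₗ[ℂ] (S → 𝔸))
        ((8 * (131072 * ((d : ℝ) + 1) ^ 2) * Real.exp (4 * (800 * ((d : ℝ) + 1) ^ 2 * ((d : ℝ) + 4)) * α₀)) * ((L : ℝ) ^ j) ^ 2) Y))
      ε₄ B'))
    (hdH : ∀ t : Icc (0:ℝ) 1, dH t = (LinearMap.pi fun x => ((ev x : (S → 𝔸) →L[ℝ] (Fin d → 𝔸)) : (S → 𝔸) →ₗ[ℝ] (Fin d → 𝔸))) ∘ₗ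
      ((fderiv ℂ (chartH179 𝒢 W D2 H₀
        (fun Y : S → 𝔸 => Y - H (Dfix (B11Eq44Concrete.Cmap L U₀ S T j) (H : (T → 𝔸) →ₗ[ℂ] (S → 𝔸))
          ((8 * (131072 * ((d : ℝ) + 1) ^ 2) * Real.exp (4 * (800 * ((d : ℝ) + 1) ^ 2 * ((d : ℝ) + 4)) * α₀)) * ((L : ℝ) ^ j) ^ 2) Y))
        ε₄) ((t : ℝ) • B)).restrictScalars ℝ : (T → 𝔸) →ₗ[ℝ] (S → 𝔸)))
    (y : (cubeGeometry L j S T).Site) :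
    (∀ t : Icc (0:ℝ) 1, Ineq190 (supSize (cubeGeometry L j S T) (boxT L j S T) (blkT L j S T) : BlockNorm (cubeGeometry L j S T) (T → 𝔸))
        (covDerivBlockSize (cubeGeometry L j S T) y₀ Sc ξ Uc) (dH t)
        (const190 1 1 b3.κ BG θW cΔ A₀ AH
          (d * Real.exp (1 / 2 * d * δ₀) *
            ((1 - (C3Gen d L * (((L : ℝ) ^ j) ^ 2 * (2 * ε₃)) * (2 * d) * B₁ * Real.exp (2 * d * δ₀)) *
                (d * B6.c0 δ₀ (1 / 2) ^ d))⁻¹ * (Real.exp (d * δ₀) * (C3Gen d L * ((L : ℝ) ^ j) ^ 2 * (2 * ε₃)))))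
          (B6.c0 δ₀ (1 / 8) ^ d)) δ₀) ∧
      ∀ s : ℝ, (∀ t, (covDerivBlockSize (cubeGeometry L j S T) y₀ Sc ξ Uc).loc y (dH t B) ≤ s) →
        (covDerivBlockSize (cubeGeometry L j S T) y₀ Sc ξ Uc).loc y (Hl B) ≤ s := by
  classical
  have hN : ∀ (y : (cubeGeometry L j S T).Site) (v : S → 𝔸),
      (supSize (cubeGeometry L j S T) (boxS L j S T) (blkS L j S T) : BlockNorm (cubeGeometry L j S T) (S → 𝔸)).loc y v ≤ ‖v‖ :=
    fun y v => loc_le_norm_supSize (blkS L j S T) y v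
  have hBloc : ∀ (y' : (cubeGeometry L j S T).Site) (μ : T → 𝔸),
      (supSize (cubeGeometry L j S T) (boxT L j S T) (blkT L j S T) : BlockNorm (cubeGeometry L j S T) (T → 𝔸)).IsLoc y' μ →
        ‖μ‖ ≤ (supSize (cubeGeometry L j S T) (boxT L j S T) (blkT L j S T) : BlockNorm (cubeGeometry L j S T) (T → 𝔸)).loc y' μ :=
    fun y' μ hμ => norm_le_loc_of_isLoc (blkT L j S T) y' μ hμ
  have htri : Triangle254 (cubeGeometry L j S T) := triangle254_cubeGeometry L j S T
  have hdist : ∀ a b : (cubeGeometry L j S T).Site, 0 ≤ (cubeGeometry L j S T).dist a b := dist_nonneg_cubeGeometry L j S T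
  have hc0 : 0 ≤ B6.c0 δ₀ (1 / 8) := tsum_nonneg fun _ => (Real.exp_pos _).le
  have hc : 0 ≤ B6.c0 δ₀ (1 / 8) ^ d := pow_nonneg hc0 d
  have hrow : RowSum (cubeGeometry L j S T) (δ₀ / 8) (B6.c0 δ₀ (1 / 8) ^ d) := by
    have h8 : δ₀ / 8 = 1 / 8 * δ₀ := by ring
    rw [h8]
    exact rowSum_cubeGeometry L j S T (by positivity)
  have hdR : (1 : ℝ) ≤ (d : ℝ) := by exact_mod_cast hd1
  have hq9 : 9 * ((8 * (131072 * ((d : ℝ) + 1) ^ 2) * Real.exp (4 * (800 * ((d : ℝ) + 1) ^ 2 * ((d : ℝ) + 4)) * α₀))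
      * ((L : ℝ) ^ j) ^ 2) * B₀' * ε₃ < 1 := by
    have hdc : 1 ≤ (d : ℝ) * c1h := by nlinarith
    have hpos : 0 ≤ ((8 * (131072 * ((d : ℝ) + 1) ^ 2) * Real.exp (4 * (800 * ((d : ℝ) + 1) ^ 2 * ((d : ℝ) + 4)) * α₀))
      * ((L : ℝ) ^ j) ^ 2) * B₀' * ε₃ := by positivity
    calc 9 * ((8 * (131072 * ((d : ℝ) + 1) ^ 2) * Real.exp (4 * (800 * ((d : ℝ) + 1) ^ 2 * ((d : ℝ) + 4)) * α₀))
          * ((L : ℝ) ^ j) ^ 2) * B₀' * ε₃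
        ≤ 9 * ((8 * (131072 * ((d : ℝ) + 1) ^ 2) * Real.exp (4 * (800 * ((d : ℝ) + 1) ^ 2 * ((d : ℝ) + 4)) * α₀))
          * ((L : ℝ) ^ j) ^ 2) * B₀' * ε₃ * ((d : ℝ) * c1h) := le_mul_of_one_le_right (by positivity) hdc
      _ = (18 * ((8 * (131072 * ((d : ℝ) + 1) ^ 2) * Real.exp (4 * (800 * ((d : ℝ) + 1) ^ 2 * ((d : ℝ) + 4)) * α₀)) *
          ((L : ℝ) ^ j) ^ 2) * B₀' * d * c1h * ε₃) / 2 := by ring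
      _ ≤ 1 / 2 := by linarith
      _ < 1 := by norm_num
  have hε3b : 3 * ε₃ < b := by linarith
  have hC3 : 0 ≤ C3Gen d L := by unfold C3Gen C1ppGen; positivity
  have h1q : 0 < 1 - (C3Gen d L * (((L : ℝ) ^ j) ^ 2 * (2 * ε₃)) * (2 * d) * B₁ * Real.exp (2 * d * δ₀)) *
      (d * B6.c0 δ₀ (1 / 2) ^ d) := by linarith
  have hθD : (0 : ℝ) ≤ (d * Real.exp (1 / 2 * d * δ₀) *
            ((1 - (C3Gen d L * (((L : ℝ) ^ j) ^ 2 * (2 * ε₃)) * (2 * d) * B₁ * Real.exp (2 * d * δ₀)) *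
                (d * B6.c0 δ₀ (1 / 2) ^ d))⁻¹ * (Real.exp (d * δ₀) * (C3Gen d L * ((L : ℝ) ^ j) ^ 2 * (2 * ε₃))))) :=
    mul_nonneg (by positivity) (mul_nonneg (inv_nonneg.2 h1q.le) (by positivity))
  have h73 : ∀ B' : T → 𝔸, ‖H₀ B'‖ < a → ‖D2 (H₀ B')‖ < jG →
      HasMaj (supSize (cubeGeometry L j S T) (boxS L j S T) (blkS L j S T) : BlockNorm (cubeGeometry L j S T) (S → 𝔸))
        (supSize (cubeGeometry L j S T) (boxT L j S T) (blkT L j S T) : BlockNorm (cubeGeometry L j S T) (T → 𝔸))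
        ((fderiv ℂ (Dfix (B11Eq44Concrete.Cmap L U₀ S T j) (H : (T → 𝔸) →ₗ[ℂ] (S → 𝔸))
          ((8 * (131072 * ((d : ℝ) + 1) ^ 2) * Real.exp (4 * (800 * ((d : ℝ) + 1) ^ 2 * ((d : ℝ) + 4)) * α₀)) * ((L : ℝ) ^ j) ^ 2))
          (solA180 𝒢 W D2 H₀ ε₄ B' + H₀ B')).restrictScalars ℝ : (S → 𝔸) →ₗ[ℝ] (T → 𝔸))
        (fun y y' => (d * Real.exp (1 / 2 * d * δ₀) *
            ((1 - (C3Gen d L * (((L : ℝ) ^ j) ^ 2 * (2 * ε₃)) * (2 * d) * B₁ * Real.exp (2 * d * δ₀)) *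
                (d * B6.c0 δ₀ (1 / 2) ^ d))⁻¹ * (Real.exp (d * δ₀) * (C3Gen d L * ((L : ℝ) ^ j) ^ 2 * (2 * ε₃))))) *
          Real.exp (-(δ₀ / 2 * (cubeGeometry L j S T).dist y y'))) := by
    intro B' h𝔄 hJ
    have hA : ‖solA180 𝒢 W D2 H₀ ε₄ B' + H₀ B'‖ < ε₃ := norm_arg180_lt_eps3 R hJ h𝔄 hnest
    exact hasMaj_fderiv_Dfix L hL hG k U₀ hU₀ hα hα3 hα4 h52 hb hsmall hc₃ h145 h155 S T H hj hB₀' hH46 hq9 hε3b hδ₀ hB₁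
      hHker hq hε₃.le hA
  have h := ineq190_and_hmv_covDerivBlockSize_concreteC L hL hG k U₀ hU₀ hα hα3 hα4 h52 hb hsmall hc₃ h145 h155 S T
    hj hd1 R hWa H hB₀' hH46 hc1h hε₃ h18 h2 hnest hB ev hP hN hBloc htri hdist hδ₀.le hrow hc hBG hθW hcΔ hA₀ hAH hθD
    hG190 hD2H0 hH0 hH h189 h73 hqG Hl dH hHl hdH y
  rw [supSize_κ, supSize_κ] at h
  exact h

include hL hG hU₀ hα hα3 hα4 h52 hb hsmall hc₃ h145 h155 in
/-- **THE END-TO-END (190) CHAIN FOR THE WEIGHTED FIRST-ORDER SIZE `ofSeminorms … (cw • covDerivSize …)` AT THE CONCRETE `C_j` ON THE CUBE GEOMETRY,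
(73)-LETTER DISCHARGED** — as above, for p29's weighted size (print's weights `(L^iη)`/`(L^{j+1}η)` of [IV] (1.45)/(1.57)).
[cite: Balaban1985Variational, Prop. 9 (190) pp.308–309, (73) p.289, Prop. 3 p.289, (115) p.294] [cite: Balaban1984PropagatorsII, Lemma 2.1 (2.61) p.234, (2.54) p.233] -/
theorem ineq190_and_hmv_ofSeminorms_concreteC_kernel {j : ℕ} (hj : j ≤ k) (hd1 : 1 ≤ d)
    (R : Regime 𝒢 0 W B₀ θ C₄ a₃ jG a ε₄) (hWa : AnalyticOnNhd ℂ W {Y : S → 𝔸 | ‖Y‖ < a₃})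
    (H : (T → 𝔸) →L[ℂ] (S → 𝔸)) {B₀' : ℝ} (hB₀' : 0 ≤ B₀') (hH46 : ∀ X, ‖H X‖ ≤ B₀' * ‖X‖)
    {c1h ε₃ : ℝ} (hc1h : 1 ≤ c1h) (hε₃ : 0 < ε₃)
    (h18 : 18 * ((8 * (131072 * ((d : ℝ) + 1) ^ 2) * Real.exp (4 * (800 * ((d : ℝ) + 1) ^ 2 * ((d : ℝ) + 4)) * α₀)) *
      ((L : ℝ) ^ j) ^ 2) * B₀' * d * c1h * ε₃ ≤ 1) (h2 : 2 * ε₃ ≤ b / 2) (hnest : ε₄ + a ≤ ε₃)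
    {δ₀ B₁ : ℝ} (hδ₀ : 0 < δ₀) (hB₁ : 0 ≤ B₁)
    (hHker : ∀ (c'' : T) (Y : 𝔸) (s : S),
      ‖H (Pi.single c'' Y) s‖ ≤ B₁ * Real.exp (-(δ₀ * ((B7Prop1Explicit.l1 (loK L j c''.1.1 - s.1.1) : ℝ) / (L : ℝ) ^ j))) * ‖Y‖)
    (hq : (C3Gen d L * (((L : ℝ) ^ j) ^ 2 * (2 * ε₃)) * (2 * d) * B₁ * Real.exp (2 * d * δ₀)) * (d * B6.c0 δ₀ (1 / 2) ^ d) < 1)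
    {B : T → 𝔸} (hB : ‖H₀ B‖ < a ∧ ‖D2 (H₀ B)‖ < jG)
    (y₀ : (cubeGeometry L j S T).Site) (Sc : (cubeGeometry L j S T).Site → Finset (B7Prop1Explicit.Site d × Fin d × Fin d))
    (ev : B7Prop1Explicit.Site d → ((S → 𝔸) →L[ℝ] (Fin d → 𝔸))) (cw : ℝ≥0) {b3 : BlockNorm (cubeGeometry L j S T) 𝒵}
    (hP : ∀ (y : (cubeGeometry L j S T).Site) (v : S → 𝔸),
      (ofSeminorms (cubeGeometry L j S T) y₀ (fun y => cw • covDerivSize (Sc y) ξ Uc)).loc y (fun x => ev x v) ≤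
        (supSize (cubeGeometry L j S T) (boxS L j S T) (blkS L j S T) : BlockNorm (cubeGeometry L j S T) (S → 𝔸)).loc y v)
    {BG θW cΔ A₀ AH : ℝ} (hBG : 0 ≤ BG) (hθW : 0 ≤ θW) (hcΔ : 0 ≤ cΔ) (hA₀ : 0 ≤ A₀) (hAH : 0 ≤ AH)
    (hG190 : HasMaj b3 (supSize (cubeGeometry L j S T) (boxS L j S T) (blkS L j S T) : BlockNorm (cubeGeometry L j S T) (S → 𝔸))
      (𝒢.restrictScalars ℝ : 𝒵 →ₗ[ℝ] (S → 𝔸)) (fun y y' => BG * Real.exp (-(δ₀ * (cubeGeometry L j S T).dist y y'))))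
    (hD2H0 : HasMaj (supSize (cubeGeometry L j S T) (boxT L j S T) (blkT L j S T) : BlockNorm (cubeGeometry L j S T) (T → 𝔸)) b3
      ((D2 ∘L H₀).restrictScalars ℝ : (T → 𝔸) →ₗ[ℝ] 𝒵) (fun y y' => cΔ * Real.exp (-(δ₀ * (cubeGeometry L j S T).dist y y'))))
    (hH0 : HasMaj (supSize (cubeGeometry L j S T) (boxT L j S T) (blkT L j S T) : BlockNorm (cubeGeometry L j S T) (T → 𝔸))
      (supSize (cubeGeometry L j S T) (boxS L j S T) (blkS L j S T) : BlockNorm (cubeGeometry L j S T) (S → 𝔸))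
      (H₀.restrictScalars ℝ : (T → 𝔸) →ₗ[ℝ] (S → 𝔸)) (fun y y' => A₀ * Real.exp (-(δ₀ * (cubeGeometry L j S T).dist y y'))))
    (hH : HasMaj (supSize (cubeGeometry L j S T) (boxT L j S T) (blkT L j S T) : BlockNorm (cubeGeometry L j S T) (T → 𝔸))
      (supSize (cubeGeometry L j S T) (boxS L j S T) (blkS L j S T) : BlockNorm (cubeGeometry L j S T) (S → 𝔸))
      (H.restrictScalars ℝ : (T → 𝔸) →ₗ[ℝ] (S → 𝔸)) (fun y y' => AH * Real.exp (-(δ₀ / 2 * (cubeGeometry L j S T).dist y y'))))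
    (h189 : ∀ B' : T → 𝔸, ‖H₀ B'‖ < a → ‖D2 (H₀ B')‖ < jG →
      Ineq189 (supSize (cubeGeometry L j S T) (boxS L j S T) (blkS L j S T) : BlockNorm (cubeGeometry L j S T) (S → 𝔸)) b3
        ((fderiv ℂ W (solA180 𝒢 W D2 H₀ ε₄ B' + H₀ B')).restrictScalars ℝ : (S → 𝔸) →ₗ[ℝ] 𝒵) θW δ₀)
    (hqG : qG b3.κ 1 BG θW (B6.c0 δ₀ (1 / 8) ^ d) < 1)
    (Hl : (T → 𝔸) → B7Prop1Explicit.Site d → Fin d → 𝔸) (dH : Icc (0:ℝ) 1 → (T → 𝔸) →ₗ[ℝ] (B7Prop1Explicit.Site d → Fin d → 𝔸))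
    (hHl : ∀ B' : T → 𝔸, Hl B' = fun x => ev x (chartH179 𝒢 W D2 H₀
      (fun Y : S → 𝔸 => Y - H (Dfix (B11Eq44Concrete.Cmap L U₀ S T j) (H : (T → 𝔸) →ₗ[ℂ] (S → 𝔸))
        ((8 * (131072 * ((d : ℝ) + 1) ^ 2) * Real.exp (4 * (800 * ((d : ℝ) + 1) ^ 2 * ((d : ℝ) + 4)) * α₀)) * ((L : ℝ) ^ j) ^ 2) Y))
      ε₄ B'))
    (hdH : ∀ t : Icc (0:ℝ) 1, dH t = (LinearMap.pi fun x => ((ev x : (S → 𝔸) →L[ℝ] (Fin d → 𝔸)) : (S → 𝔸) →ₗ[ℝ] (Fin d → 𝔸))) ∘ₗ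
      ((fderiv ℂ (chartH179 𝒢 W D2 H₀
        (fun Y : S → 𝔸 => Y - H (Dfix (B11Eq44Concrete.Cmap L U₀ S T j) (H : (T → 𝔸) →ₗ[ℂ] (S → 𝔸))
          ((8 * (131072 * ((d : ℝ) + 1) ^ 2) * Real.exp (4 * (800 * ((d : ℝ) + 1) ^ 2 * ((d : ℝ) + 4)) * α₀)) * ((L : ℝ) ^ j) ^ 2) Y))
        ε₄) ((t : ℝ) • B)).restrictScalars ℝ : (T → 𝔸) →ₗ[ℝ] (S → 𝔸)))
    (y : (cubeGeometry L j S T).Site) :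
    (∀ t : Icc (0:ℝ) 1, Ineq190 (supSize (cubeGeometry L j S T) (boxT L j S T) (blkT L j S T) : BlockNorm (cubeGeometry L j S T) (T → 𝔸))
        (ofSeminorms (cubeGeometry L j S T) y₀ (fun y => cw • covDerivSize (Sc y) ξ Uc)) (dH t)
        (const190 1 1 b3.κ BG θW cΔ A₀ AH
          (d * Real.exp (1 / 2 * d * δ₀) *
            ((1 - (C3Gen d L * (((L : ℝ) ^ j) ^ 2 * (2 * ε₃)) * (2 * d) * B₁ * Real.exp (2 * d * δ₀)) *
                (d * B6.c0 δ₀ (1 / 2) ^ d))⁻¹ * (Real.exp (d * δ₀) * (C3Gen d L * ((L : ℝ) ^ j) ^ 2 * (2 * ε₃)))))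
          (B6.c0 δ₀ (1 / 8) ^ d)) δ₀) ∧
      ∀ s : ℝ, (∀ t, (ofSeminorms (cubeGeometry L j S T) y₀ (fun y => cw • covDerivSize (Sc y) ξ Uc)).loc y (dH t B) ≤ s) →
        (ofSeminorms (cubeGeometry L j S T) y₀ (fun y => cw • covDerivSize (Sc y) ξ Uc)).loc y (Hl B) ≤ s := by
  classical
  have hN : ∀ (y : (cubeGeometry L j S T).Site) (v : S → 𝔸),
      (supSize (cubeGeometry L j S T) (boxS L j S T) (blkS L j S T) : BlockNorm (cubeGeometry L j S T) (S → 𝔸)).loc y v ≤ ‖v‖ :=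
    fun y v => loc_le_norm_supSize (blkS L j S T) y v
  have hBloc : ∀ (y' : (cubeGeometry L j S T).Site) (μ : T → 𝔸),
      (supSize (cubeGeometry L j S T) (boxT L j S T) (blkT L j S T) : BlockNorm (cubeGeometry L j S T) (T → 𝔸)).IsLoc y' μ →
        ‖μ‖ ≤ (supSize (cubeGeometry L j S T) (boxT L j S T) (blkT L j S T) : BlockNorm (cubeGeometry L j S T) (T → 𝔸)).loc y' μ :=
    fun y' μ hμ => norm_le_loc_of_isLoc (blkT L j S T) y' μ hμ
  have htri : Triangle254 (cubeGeometry L j S T) := triangle254_cubeGeometry L j S T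
  have hdist : ∀ a b : (cubeGeometry L j S T).Site, 0 ≤ (cubeGeometry L j S T).dist a b := dist_nonneg_cubeGeometry L j S T
  have hc0 : 0 ≤ B6.c0 δ₀ (1 / 8) := tsum_nonneg fun _ => (Real.exp_pos _).le
  have hc : 0 ≤ B6.c0 δ₀ (1 / 8) ^ d := pow_nonneg hc0 d
  have hrow : RowSum (cubeGeometry L j S T) (δ₀ / 8) (B6.c0 δ₀ (1 / 8) ^ d) := by
    have h8 : δ₀ / 8 = 1 / 8 * δ₀ := by ring
    rw [h8]
    exact rowSum_cubeGeometry L j S T (by positivity)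
  have hdR : (1 : ℝ) ≤ (d : ℝ) := by exact_mod_cast hd1
  have hq9 : 9 * ((8 * (131072 * ((d : ℝ) + 1) ^ 2) * Real.exp (4 * (800 * ((d : ℝ) + 1) ^ 2 * ((d : ℝ) + 4)) * α₀))
      * ((L : ℝ) ^ j) ^ 2) * B₀' * ε₃ < 1 := by
    have hdc : 1 ≤ (d : ℝ) * c1h := by nlinarith
    have hpos : 0 ≤ ((8 * (131072 * ((d : ℝ) + 1) ^ 2) * Real.exp (4 * (800 * ((d : ℝ) + 1) ^ 2 * ((d : ℝ) + 4)) * α₀))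
      * ((L : ℝ) ^ j) ^ 2) * B₀' * ε₃ := by positivity
    calc 9 * ((8 * (131072 * ((d : ℝ) + 1) ^ 2) * Real.exp (4 * (800 * ((d : ℝ) + 1) ^ 2 * ((d : ℝ) + 4)) * α₀))
          * ((L : ℝ) ^ j) ^ 2) * B₀' * ε₃
        ≤ 9 * ((8 * (131072 * ((d : ℝ) + 1) ^ 2) * Real.exp (4 * (800 * ((d : ℝ) + 1) ^ 2 * ((d : ℝ) + 4)) * α₀))
          * ((L : ℝ) ^ j) ^ 2) * B₀' * ε₃ * ((d : ℝ) * c1h) := le_mul_of_one_le_right (by positivity) hdc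
      _ = (18 * ((8 * (131072 * ((d : ℝ) + 1) ^ 2) * Real.exp (4 * (800 * ((d : ℝ) + 1) ^ 2 * ((d : ℝ) + 4)) * α₀)) *
          ((L : ℝ) ^ j) ^ 2) * B₀' * d * c1h * ε₃) / 2 := by ring
      _ ≤ 1 / 2 := by linarith
      _ < 1 := by norm_num
  have hε3b : 3 * ε₃ < b := by linarith
  have hC3 : 0 ≤ C3Gen d L := by unfold C3Gen C1ppGen; positivity
  have h1q : 0 < 1 - (C3Gen d L * (((L : ℝ) ^ j) ^ 2 * (2 * ε₃)) * (2 * d) * B₁ * Real.exp (2 * d * δ₀)) *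
      (d * B6.c0 δ₀ (1 / 2) ^ d) := by linarith
  have hθD : (0 : ℝ) ≤ (d * Real.exp (1 / 2 * d * δ₀) *
            ((1 - (C3Gen d L * (((L : ℝ) ^ j) ^ 2 * (2 * ε₃)) * (2 * d) * B₁ * Real.exp (2 * d * δ₀)) *
                (d * B6.c0 δ₀ (1 / 2) ^ d))⁻¹ * (Real.exp (d * δ₀) * (C3Gen d L * ((L : ℝ) ^ j) ^ 2 * (2 * ε₃))))) :=
    mul_nonneg (by positivity) (mul_nonneg (inv_nonneg.2 h1q.le) (by positivity))
  have h73 : ∀ B' : T → 𝔸, ‖H₀ B'‖ < a → ‖D2 (H₀ B')‖ < jG →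
      HasMaj (supSize (cubeGeometry L j S T) (boxS L j S T) (blkS L j S T) : BlockNorm (cubeGeometry L j S T) (S → 𝔸))
        (supSize (cubeGeometry L j S T) (boxT L j S T) (blkT L j S T) : BlockNorm (cubeGeometry L j S T) (T → 𝔸))
        ((fderiv ℂ (Dfix (B11Eq44Concrete.Cmap L U₀ S T j) (H : (T → 𝔸) →ₗ[ℂ] (S → 𝔸))
          ((8 * (131072 * ((d : ℝ) + 1) ^ 2) * Real.exp (4 * (800 * ((d : ℝ) + 1) ^ 2 * ((d : ℝ) + 4)) * α₀)) * ((L : ℝ) ^ j) ^ 2))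
          (solA180 𝒢 W D2 H₀ ε₄ B' + H₀ B')).restrictScalars ℝ : (S → 𝔸) →ₗ[ℝ] (T → 𝔸))
        (fun y y' => (d * Real.exp (1 / 2 * d * δ₀) *
            ((1 - (C3Gen d L * (((L : ℝ) ^ j) ^ 2 * (2 * ε₃)) * (2 * d) * B₁ * Real.exp (2 * d * δ₀)) *
                (d * B6.c0 δ₀ (1 / 2) ^ d))⁻¹ * (Real.exp (d * δ₀) * (C3Gen d L * ((L : ℝ) ^ j) ^ 2 * (2 * ε₃))))) *
          Real.exp (-(δ₀ / 2 * (cubeGeometry L j S T).dist y y'))) := by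
    intro B' h𝔄 hJ
    have hA : ‖solA180 𝒢 W D2 H₀ ε₄ B' + H₀ B'‖ < ε₃ := norm_arg180_lt_eps3 R hJ h𝔄 hnest
    exact hasMaj_fderiv_Dfix L hL hG k U₀ hU₀ hα hα3 hα4 h52 hb hsmall hc₃ h145 h155 S T H hj hB₀' hH46 hq9 hε3b hδ₀ hB₁
      hHker hq hε₃.le hA
  have h := ineq190_and_hmv_ofSeminorms_concreteC L hL hG k U₀ hU₀ hα hα3 hα4 h52 hb hsmall hc₃ h145 h155 S T
    hj hd1 R hWa H hB₀' hH46 hc1h hε₃ h18 h2 hnest hB ev cw hP hN hBloc htri hdist hδ₀.le hrow hc hBG hθW hcΔ hA₀ hAH hθD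
    hG190 hD2H0 hH0 hH h189 h73 hqG Hl dH hHl hdH y
  rw [supSize_κ, supSize_κ] at h
  exact h

end Kernel

end Literature.MathematicalPhysics.QuantumFieldTheory.Balaban1983to89.B11Ineq190DerivConcreteC

end
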